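import Mathlib
import Literature.AlgebraicGeometry.Resolution.CobordantGame
import Summits.ResolutionOfSingularities.ResolutionOfSingularities.Theses.WeightedInvariant
import Summits.ResolutionOfSingularities.ResolutionOfSingularities.Theorems.WeightedInvariantGlobalizeLocalDropCanonize
import Summits.ResolutionOfSingularities.ResolutionOfSingularities.Theorems.WeightedInvariantGlobalizeLocalDropCylinder
import Summits.ResolutionOfSingularities.ResolutionOfSingularities.Theorems.WeightedInvariantLocalWeightedDropPurePowerWon
import Summits.ResolutionOfSingularities.ResolutionOfSingularities.Theorems.WeightedInvariantLocalWeightedDropContactApprox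
import Summits.ResolutionOfSingularities.ResolutionOfSingularities.Theorems.WeightedInvariantLocalWeightedDropApproxPowerExact
import Summits.ResolutionOfSingularities.ResolutionOfSingularities.Theorems.WeightedInvariantLocalWeightedDropPrepareContact
import Summits.ResolutionOfSingularities.ResolutionOfSingularities.Theorems.WeightedInvariantLocalWeightedDropFaceDropPlane
import Summits.ResolutionOfSingularities.ResolutionOfSingularities.Theorems.WeightedInvariantLocalWeightedDropPlaneAssembly

/-!
# `LocalWeightedDrop`: plane-curve starts are WON, and the crux is its own restriction to dimension `≥ 3`

Route `ResolutionOfSingularities/WeightedInvariant`, crux `LocalWeightedDrop` (item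
stmt-ResolutionOfSingularities-8899), line `hasse-ridge-face-selection` (third lead).  In the inductive normal
form of the crux (`localWeightedDrop_iff_allWon`: over every algebraically closed field of prime
characteristic every singular germ `f ∈ k[[x₁,…,x_n]]` is in the winning region `CobordantGame.Won` of the local
weighted resolution game) this file records what the line PROVED and what it leaves:

* `stub_planeWon` — the CALIBRATION the route header asks for ("n = 2 plane-curve start where AQS stop",
  arXiv:2412.16426): every singular plane germ over an algebraically closed field of ANY characteristic is won.
  Rank = ORDER; strategy = tame face selection on the Newton polygon: a pure power `u·L^d` (`L` smooth) is won by
  one divisorial move (`stub_purePowerWon`, every dimension); otherwise the contact numbers are bounded (key lemma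
  "unbounded contact ⇒ `u·L^d`": `stub_contactApprox` + `stub_approxPowerExact`), prepared maximal-contact
  coordinates exist (`stub_prepareContact`), and the face-selected move `(Φ, (1, N))` drops the order of the tame
  flat slice at every singular successor (`stub_faceDropPlane`); the successor is a unit times a coordinate change
  of the cylinder over that slice (lead a's landed tame slice), hence won by induction on the order
  (`stub_planeAssembly`).  All six pieces are landed Theorems files; this theorem is their composition.
* `lineWon` — one variable: `f = xᵃ·unit` is won in one move; `not_isSingular_fin_zero` — no singular germ in
  zero variables.
* `localWeightedDrop_iff_higherStartsWon` — CONSEQUENTLY the crux is EQUIVALENT to its restriction to starting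
  embedding dimension `n ≥ 3` ("every singular germ in `≥ 3` variables over an algebraically closed field of
  characteristic `p` is won").  That restriction is the line's one remaining stub `stub_higherStartsWon` and the
  open core of the route: no positional rank for the weighted cobordant game on surface germs in characteristic
  `p` is in print, and the plane recipe (rank = order) is refuted in three variables by `x² + y³z²`
  (cdisprove `localWeightedDropOrder_false`).
-/

set_option linter.dupNamespace false -- mandated namespace of this single-conjunct summit

namespace Summit.ResolutionOfSingularities.ResolutionOfSingularities.Theorems

open Literature.AlgebraicGeometry.Resolution
open Summit.ResolutionOfSingularities.ResolutionOfSingularities.Theses.WeightedInvariant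

/-- PLANE-CURVE STARTS ARE WON (registered stub `stub_planeWon` of the line `hasse-ridge-face-selection`):
every singular `f ∈ k[[x,y]]` over an algebraically closed field `k` (any characteristic) is in the winning
region of the local weighted resolution game — the composition of the six landed plane pieces. -/
theorem stub_planeWon : ∀ (k : Type) [Field k] [IsAlgClosed k] (f : MvPowerSeries (Fin 2) k),
    CobordantGame.IsSingular k f → CobordantGame.Won k 2 f :=
  stub_planeAssembly stub_purePowerWon stub_contactApprox stub_approxPowerExact stub_prepareContact
    stub_faceDropPlane

namespace PlaneWon

variable {k : Type} [Field k]

/-- In zero variables there is no singular germ (a series in no variables is its constant coefficient). -/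
theorem not_isSingular_fin_zero (f : MvPowerSeries (Fin 0) k) : ¬ CobordantGame.IsSingular k f := by
  rintro ⟨hf, hf0, -⟩
  apply hf
  ext d
  have hd : d = 0 := Subsingleton.elim d 0
  subst hd
  simpa using hf0

/-- ONE VARIABLE: every singular `f ∈ k[[x]]` is `xᵃ · unit`, hence won in one move (`stub_purePowerWon`
with `L = x`). -/
theorem lineWon (f : MvPowerSeries (Fin 1) k) (hf : CobordantGame.IsSingular k f) :
    CobordantGame.Won k 1 f := by
  obtain ⟨a, g, hfac, hndvd⟩ := exists_eq_X_pow_mul_not_dvd (0 : Fin 1) hf.1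
  have hg : MvPowerSeries.constantCoeff g ≠ 0 := by
    intro h0
    apply hndvd
    rw [MvPowerSeries.X_dvd_iff]
    intro m hm
    have hm0 : m = 0 := by
      apply Finsupp.ext
      intro i
      have hi : i = 0 := Subsingleton.elim i 0
      subst hi
      simpa using hm
    subst hm0
    simpa using h0
  have hX0 : MvPowerSeries.constantCoeff (MvPowerSeries.X (0 : Fin 1) : MvPowerSeries (Fin 1) k) = 0 :=
    MvPowerSeries.constantCoeff_X 0
  have hX1 : ∃ i, MvPowerSeries.coeff (Finsupp.single i 1)
      (MvPowerSeries.X (0 : Fin 1) : MvPowerSeries (Fin 1) k) ≠ 0 :=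
    ⟨0, by rw [MvPowerSeries.coeff_X, if_pos rfl]; exact one_ne_zero⟩
  have hW := stub_purePowerWon k 0 g (MvPowerSeries.X 0) a hg hX0 hX1
  rw [mul_comm, ← hfac] at hW
  exact hW.won

/-- STARTS OF DIMENSION `≤ 2` ARE WON over an algebraically closed field (any characteristic): the case split
`n = 0` (vacuous), `n = 1` (`lineWon`), `n = 2` (`stub_planeWon`). -/
theorem lowStartsWon (k : Type) [Field k] [IsAlgClosed k] {n : ℕ} (hn : n ≤ 2) (f : MvPowerSeries (Fin n) k)
    (hf : CobordantGame.IsSingular k f) : CobordantGame.Won k n f := by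
  match n, f, hf with
  | 0, f, hf => exact absurd hf (not_isSingular_fin_zero f)
  | 1, f, hf => exact lineWon f hf
  | 2, f, hf => exact stub_planeWon k f hf
  | n + 3, _, _ => omega

end PlaneWon

/-- THE CRUX IS ITS OWN RESTRICTION TO STARTING DIMENSION `≥ 3`: `LocalWeightedDrop` holds iff over every
algebraically closed field of prime characteristic every singular germ in `n + 3` variables is won.  (`→` is
the inductive normal form; `←` adds the won low-dimensional starts `PlaneWon.lowStartsWon`.)  This is the exact
content of the line's remaining stub `stub_higherStartsWon`. -/
theorem localWeightedDrop_iff_higherStartsWon :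
    LocalWeightedDrop ↔ ∀ (p : ℕ), p.Prime → ∀ (k : Type) [Field k] [CharP k p] [IsAlgClosed k]
      (n : ℕ) (f : MvPowerSeries (Fin (n + 3)) k),
      CobordantGame.IsSingular k f → CobordantGame.Won k (n + 3) f := by
  rw [localWeightedDrop_iff_allWon]
  constructor
  · intro h p hp k _ _ _ n f hf
    exact h p hp k (n + 3) f hf
  · intro h p hp k _ _ _ n f hf
    match n, f, hf with
    | 0, f, hf => exact PlaneWon.lowStartsWon k (by omega) f hf
    | 1, f, hf => exact PlaneWon.lowStartsWon k (by omega) f hf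
    | 2, f, hf => exact PlaneWon.lowStartsWon k (by omega) f hf
    | n + 3, f, hf => exact h p hp k n f hf

end Summit.ResolutionOfSingularities.ResolutionOfSingularities.Theorems
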